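import Summits.QuantumFields.YangMills.Theorems.BalabanUVNodesN12BlockChains
import HarnessLib

/-!
# BalabanUVNodes ∕ N12 — CHAINS ACROSS `∂Ω_{n+1}` AT THE RECORD's `𝐁_k(Z)`: the `(n+1)`-block adjacent to a `Γ_{n+1}`-block and outside `Ω_{n+1}` has ALL its `n`-sub-blocks in `Γ_n` (the printed
# collar [III] (2.13)), so the centre of the member block and the centre of any `n`-block of the outside neighbour are joined by a chain of `≤ d·(L−1)∕2 + 1` MEMBER bonds — part 1∕2 of the
# (G-c) ROOT CHAINS for the corridor half of [Balaban1985Variational] (16)–(18)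

Cell `pub-ymgap` (HUMAN RULINGS D-0062 ∕ D-0149), WIDTH SEAT `pub-ymgap-dag-n12-w3` g4 (node N12 = [B15]; key K1⁹ `stmt-QuantumFields-27364` (KEY MAP v2), `--kind proof --supports … --as
helper`; count-neutral).  THEOREMS ONLY (0 `def`, 0 `instance`, 0 `sorry`); consumed BY NAME: this lineage's `N12BjCollarRoots` (`mem_maxDomT_pred_of_blockIdx` = the printed collar at the fine
level, `idx_adj_of_bond`, `mem_maxDomT_iff_of_iterBlockOf_eq`, `(not_)mem_maxDomT_of_iterBlockOf_mem_Bj`), `N12BlockChains` (in-block paths, fine segments, chain composition).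

WHY (dag-n12-w6 g2 INTENT-3 `B15Prop1InteriorLetterCorridor`, cell bus 2026-08-28: the corridor half of the interior letter REDUCES to a ROOT-TRANSPORTER LETTER `hT` — per two-root bond a fine
word between the roots whose transport is near a near-`1` group element; SECOND LAYER = the chain geometry of `𝐁_k(Z)`).  In the forest gauge of the tower forest of `𝐁_k(Z)` the transporter
between two roots is read along a CHAIN OF MEMBER BONDS (dag-n12-w6 Q2-DESIGN §8): each member `c` of level `i` contributes the straight fine segment of `L^i` letters between `ι_i c₋` and
`ι_i c₊`.  THIS FILE: §0 one link (forward ∕ backward segment, the addressing clause of a one-link chain); §1 ★★ `mem_Bj_pred_of_outside` — if the `(n+1)`-block of `x` is a member, `w ∉ Ω_{n+1}`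
and the two `(n+1)`-blocks are the ends of a lattice bond, EVERY site of the block of `w` has its `n`-block in `Γ_n` (outside `Ω_{n+1}` with `w` by block union, inside `Ω_n` by
`dist(Ω_{n+1}, Ω_nᶜ) ≥ L^{n+1}M₁`, `M₁ ≥ 2`), hence every level-`n` bond touching that block and the `(n+1)`-bond joining the blocks are MEMBERS; §2 ★★ `exists_chain_across` — the chains
`ι_{n+1}B₀ ⇝ ι_n(B^n w)` and back (the member `(n+1)`-bond, then a level-`n` lattice path inside the outside block from its centre).  Part 2∕2 (`…N12BjRootChains`) assembles the root chains.

HONEST FRAMING.  Lattice bookkeeping by name; no analysis; nothing of Bałaban's asserted; N12 NOT discharged; K1⁹ NOT closed; counts unmoved (typed 28∕28 · discharged 5∕27); one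
finite 𝕋⁴ programme at fixed ε — R4 closes the conditional rung `BalabanLadder.UV` only; the Yang–Mills mass gap (Clay) is NOT proved by any of this; nothing continuum ∕ ℝ⁴ ∕ OS.
-/

noncomputable section

namespace Summit.QuantumFields.YangMills.BalabanUVNodes.N12BjAcrossChains


open scoped BigOperators
open Literature.MathematicalPhysics.QuantumFieldTheory.Balaban1983to89
open T4Continuum
open B15DeterminingSets
open B5Eq118OneStroke (iterBlockOf iterBlockOf_succ)
open B14.Eq213MaximalDomains (side)
open B14.Eq213DetSet (Bj Bj_zero Bj_mid Bj_top Bj_of_gt maxDomT maxDomT_antitone)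
open Literature.MathematicalPhysics.QuantumFieldTheory.BalabanImbrieJaffe1984to88.BIJ88RT51Background (iterBlockOf_embIter)
open Summit.QuantumFields.YangMills.BalabanUVNodes.N07CritMultiScaleLamBond (iterBlockOf_congr_of_le)
open Summit.QuantumFields.YangMills.BalabanUVNodes.N12FlatHndRecordLetters (hcov_Bj)
open Summit.QuantumFields.YangMills.BalabanUVNodes.N12BjCollarRoots
open Summit.QuantumFields.YangMills.BalabanUVNodes.N12BlockChains
open B6CubeRightLegsV1 (iterBlockOf_shift_or)

variable {P : Params}

/-! ## §0 One link: the straight segment of a member bond, forward or backward -/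

section Links

/-- The forward segment of a level-`i` bond ends at `ι_i c₊`. [cite: Balaban1987RG1, (0.1) p.251 (bookkeeping)] -/
theorem walkEnd_seg_true (i : ℕ) (c : PBond P i) : walkEnd (embIter i c.src) (List.replicate (P.L ^ i) (c.dir, true)) = embIter i c.tgt :=
  (embIter_shift_eq_walkEnd i c.src c.dir).symm

/-- The backward segment of a level-`i` bond, read from `ι_i c₊`, ends at `ι_i c₋`. [cite: Balaban1987RG1, (0.1) p.251 (bookkeeping)] -/
theorem walkEnd_seg_false (i : ℕ) (c : PBond P i) : walkEnd (embIter i c.tgt) (List.replicate (P.L ^ i) (c.dir, false)) = embIter i c.src := by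
  have h := embIter_unshift_eq_walkEnd i c.tgt c.dir
  rw [show c.tgt.unshift c.dir = c.src from B10StarCount.unshift_shift c.src c.dir] at h
  exact h.symm

/-- A ONE-LINK CHAIN read from its start: the addressing clause. [folklore] -/
theorem cons_single (l : (n : ℕ) × (PBond P n × Bool)) (r : Site P 0)
    (hr : (l.2.2 = true → r = embIter l.1 l.2.1.src) ∧ (l.2.2 = false → r = embIter l.1 l.2.1.tgt)) :
    ∀ (pre post : List ((n : ℕ) × (PBond P n × Bool))) (l' : (n : ℕ) × (PBond P n × Bool)), [l] = pre ++ l' :: post →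
      (l'.2.2 = true → walkEnd r (pre.map fun l => List.replicate (P.L ^ l.1) (l.2.1.dir, l.2.2)).flatten = embIter l'.1 l'.2.1.src) ∧
      (l'.2.2 = false → walkEnd r (pre.map fun l => List.replicate (P.L ^ l.1) (l.2.1.dir, l.2.2)).flatten = embIter l'.1 l'.2.1.tgt) := by
  intro pre post l' h
  rcases pre with _ | ⟨p, pre'⟩
  · rw [List.nil_append] at h
    have hl : l = l' := (List.cons.inj h).1
    subst hl
    simp only [List.map_nil, List.flatten_nil, walkEnd]
    exact hr
  · rw [List.cons_append] at h
    have h' := congrArg List.length (List.cons.inj h).2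
    simp only [List.length_nil, List.length_append, List.length_cons] at h'
    omega

/-- A ONE-LINK CHAIN read from its start ends at its other embedded endpoint. [folklore] -/
theorem walkEnd_single (l : (n : ℕ) × (PBond P n × Bool)) (r : Site P 0)
    (hr : (l.2.2 = true → r = embIter l.1 l.2.1.src) ∧ (l.2.2 = false → r = embIter l.1 l.2.1.tgt)) :
    walkEnd r ([l].map fun l => List.replicate (P.L ^ l.1) (l.2.1.dir, l.2.2)).flatten = if l.2.2 then embIter l.1 l.2.1.tgt else embIter l.1 l.2.1.src := by
  rw [List.map_singleton, List.flatten_singleton]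
  cases h2 : l.2.2
  · rw [hr.2 h2]; exact walkEnd_seg_false l.1 l.2.1
  · rw [hr.1 h2]; exact walkEnd_seg_true l.1 l.2.1

end Links

/-! ## §1 The `(n+1)`-block adjacent to a `Γ_{n+1}`-block and outside `Ω_{n+1}`: all its `n`-sub-blocks are members of level `n` -/

section Outside

variable {M₁ k : ℕ} {Z : Set (Site P 0)}

/-- ★★ **THE OUTSIDE NEIGHBOUR BLOCK IS ALL `Γ_n`** (the printed collar at work): if the `(n+1)`-block of `x` is a member of `𝐁_k(Z)` (`n + 1 ≤ k`, `M₁ ≥ 2`), `w ∉ Ω_{n+1}`, and the `(n+1)`-blocks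
of `x` and `w` are the two ends of a lattice bond `C` of level `n + 1`, then EVERY site of the `(n+1)`-block of `w` has its `n`-block in `Γ_n`: outside `Ω_{n+1}` with `w` (block union), inside
`Ω_n` by `dist(Ω_{n+1}, Ω_nᶜ) ≥ L^{n+1} M₁` (`N12BjCollarRoots.mem_maxDomT_pred_of_blockIdx`). [cite: Balaban1988Convergent, (2.2) p.255, (2.13) pp.256–257] -/
theorem mem_Bj_pred_of_outside (hM2 : 2 ≤ M₁) (hdiv : side P.L M₁ k ∣ P.sitesPerDir 0) (hk : k ≤ P.m + P.K) {n : ℕ} (hn : n + 1 ≤ k)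
    {x w : Site P 0} (hx : iterBlockOf (n + 1) x ∈ (Bj M₁ Z k : DetSet P) (n + 1)) (hw : w ∉ maxDomT M₁ Z (n + 1))
    (C : PBond P (n + 1)) (hC : (C.src = iterBlockOf (n + 1) x ∧ C.tgt = iterBlockOf (n + 1) w) ∨ (C.tgt = iterBlockOf (n + 1) x ∧ C.src = iterBlockOf (n + 1) w))
    {z : Site P 0} (hz : iterBlockOf (n + 1) z = iterBlockOf (n + 1) w) : iterBlockOf n z ∈ (Bj M₁ Z k : DetSet P) n := by
  have hM : 1 ≤ M₁ := by omega
  have hadj : ∀ κ, iterBlockOf (n + 1) w κ = iterBlockOf (n + 1) x κ ∨ iterBlockOf (n + 1) w κ = iterBlockOf (n + 1) x κ + 1 ∨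
      iterBlockOf (n + 1) x κ = iterBlockOf (n + 1) w κ + 1 := by
    rcases hC with ⟨h1, h2⟩ | ⟨h1, h2⟩
    · exact idx_adj_of_bond C (Or.inl h1.symm) (Or.inr h2.symm)
    · exact idx_adj_of_bond C (Or.inr h1.symm) (Or.inl h2.symm)
  have hout : ∀ {z' : Site P 0}, iterBlockOf (n + 1) z' = iterBlockOf (n + 1) w → z' ∉ maxDomT M₁ Z (n + 1) := fun {z'} hz' hz'Ω =>
    hw ((mem_maxDomT_iff_of_iterBlockOf_eq hM hdiv hk (by omega) hn le_rfl hz').1 hz'Ω)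
  rcases Nat.eq_zero_or_pos n with rfl | hn0
  · rw [Bj_zero (by omega)]
    exact hout hz
  · rw [Bj_mid hn0 (by omega)]
    have hzz : iterBlockOf n (embIter n (iterBlockOf n z)) = iterBlockOf n z := iterBlockOf_embIter n (by omega) _
    have hzz1 : iterBlockOf (n + 1) (embIter n (iterBlockOf n z)) = iterBlockOf (n + 1) w := (iterBlockOf_congr_of_le (Nat.le_succ n) hzz).trans hz
    refine ⟨?_, hout hzz1⟩
    have h := mem_maxDomT_pred_of_blockIdx hM2 hdiv hk (N := n + 1) (by omega) hn (i := n + 1) le_rfl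
      (mem_maxDomT_of_iterBlockOf_mem_Bj hM hdiv hk (by omega) hx) (z := embIter n (iterBlockOf n z)) (fun κ => by rw [hzz1]; exact hadj κ)
    rw [Nat.add_sub_cancel] at h
    exact h

/-- Hence every level-`n` bond with an end in that block is a MEMBER of level `n`. [cite: Balaban1988Convergent, (2.2) p.255, (2.13) pp.256–257] -/
theorem mem_bondsOf_of_outside (hM2 : 2 ≤ M₁) (hdiv : side P.L M₁ k ∣ P.sitesPerDir 0) (hk : k ≤ P.m + P.K) {n : ℕ} (hn : n + 1 ≤ k)
    {x w : Site P 0} (hx : iterBlockOf (n + 1) x ∈ (Bj M₁ Z k : DetSet P) (n + 1)) (hw : w ∉ maxDomT M₁ Z (n + 1))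
    (C : PBond P (n + 1)) (hC : (C.src = iterBlockOf (n + 1) x ∧ C.tgt = iterBlockOf (n + 1) w) ∨ (C.tgt = iterBlockOf (n + 1) x ∧ C.src = iterBlockOf (n + 1) w))
    (c : PBond P n) (hc : blockOf c.src = iterBlockOf (n + 1) w ∨ blockOf c.tgt = iterBlockOf (n + 1) w) : c ∈ bondsOf ((Bj M₁ Z k : DetSet P) n) := by
  have key : ∀ q : Site P n, blockOf q = iterBlockOf (n + 1) w → q ∈ (Bj M₁ Z k : DetSet P) n := fun q hq => by
    have hq' : iterBlockOf n (embIter n q) = q := iterBlockOf_embIter n (by omega) q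
    have h := mem_Bj_pred_of_outside hM2 hdiv hk hn hx hw C hC (z := embIter n q) (by rw [iterBlockOf_succ, hq', hq])
    rwa [hq'] at h
  rcases hc with h | h
  · exact Or.inl (key _ h)
  · exact Or.inr (key _ h)

/-- A point whose `J`-block is a member is in no `Ω_N`, `J < N ≤ k`; in particular the centre `ι_n q` of a member `q ∈ Γ_n`, `n < k`, lies outside `Ω_{n+1}`. [cite: Balaban1988Convergent, (2.2) p.255] -/
theorem embIter_not_mem_maxDomT_succ (hM2 : 2 ≤ M₁) (hdiv : side P.L M₁ k ∣ P.sitesPerDir 0) (hk : k ≤ P.m + P.K) {n : ℕ} (hn : n + 1 ≤ k)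
    {q : Site P n} (hq : q ∈ (Bj M₁ Z k : DetSet P) n) : embIter n q ∉ maxDomT M₁ Z (n + 1) :=
  not_mem_maxDomT_of_iterBlockOf_mem_Bj (by omega) hdiv hk (Nat.lt_succ_self n) hn (by rw [iterBlockOf_embIter n (by omega)]; exact hq)

/-- Two fine points, one inside `Ω_N` and one outside, lie in different `N`-blocks (`1 ≤ N ≤ k`). [cite: Balaban1988Convergent, (2.13) pp.256–257] -/
theorem iterBlockOf_ne_of_mem_not_mem (hM2 : 2 ≤ M₁) (hdiv : side P.L M₁ k ∣ P.sitesPerDir 0) (hk : k ≤ P.m + P.K) {N : ℕ} (hN1 : 1 ≤ N) (hNk : N ≤ k)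
    {x w : Site P 0} (hx : x ∈ maxDomT M₁ Z N) (hw : w ∉ maxDomT M₁ Z N) : iterBlockOf N x ≠ iterBlockOf N w := fun h =>
  hw ((mem_maxDomT_iff_of_iterBlockOf_eq (by omega) hdiv hk hN1 hNk le_rfl h).1 hx)

end Outside

/-! ## §2 Across the boundary of `Ω_{n+1}`: chains between the centre of a `Γ_{n+1}`-block and the centre of an `n`-block of the outside neighbour -/

section Across

variable {M₁ k : ℕ} {Z : Set (Site P 0)}

/-- ★★ **CHAINS ACROSS `∂Ω_{n+1}`.**  Data: the `(n+1)`-block `B₀` of `x` a member, `w ∉ Ω_{n+1}`, a level-`(n+1)` bond `C` joining `B₀` and the block `B₁` of `w`.  THEN (a) the `n`-block of `w` is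
a member of level `n`; (b) a chain of `≤ d·(L−1)∕2 + 1` links — `C` (oriented from `B₀` to `B₁`), then a lattice path of level-`n` members inside `B₁` from its centre to the `n`-block of
`w` — whose segment words are consecutive from `ι_{n+1} B₀` and end at `ι_n(B^n w)`; (c) the same backwards, from `ι_n(B^n w)` to `ι_{n+1} B₀`.  Every link is a member of level `≤ k`.
[cite: Balaban1988Convergent, (2.2) p.255, (2.13) pp.256–257; Balaban1985Variational, (16)–(18) p.280] -/
theorem exists_chain_across (hM2 : 2 ≤ M₁) (hdiv : side P.L M₁ k ∣ P.sitesPerDir 0) (hk : k ≤ P.m + P.K) {n : ℕ} (hn : n + 1 ≤ k)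
    {x w : Site P 0} (hx : iterBlockOf (n + 1) x ∈ (Bj M₁ Z k : DetSet P) (n + 1)) (hw : w ∉ maxDomT M₁ Z (n + 1))
    (C : PBond P (n + 1)) (hC : (C.src = iterBlockOf (n + 1) x ∧ C.tgt = iterBlockOf (n + 1) w) ∨ (C.tgt = iterBlockOf (n + 1) x ∧ C.src = iterBlockOf (n + 1) w)) :
    iterBlockOf n w ∈ (Bj M₁ Z k : DetSet P) n ∧
    (∃ links : List ((m : ℕ) × (PBond P m × Bool)), links.length ≤ P.d * ((P.L - 1) / 2) + 1 ∧
      (∀ l ∈ links, l.1 ≤ k ∧ l.2.1 ∈ bondsOf ((Bj M₁ Z k : DetSet P) l.1)) ∧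
      walkEnd (embIter (n + 1) (iterBlockOf (n + 1) x)) (links.map fun l => List.replicate (P.L ^ l.1) (l.2.1.dir, l.2.2)).flatten = embIter n (iterBlockOf n w) ∧
      ∀ (pre post : List ((m : ℕ) × (PBond P m × Bool))) (l : (m : ℕ) × (PBond P m × Bool)), links = pre ++ l :: post →
        (l.2.2 = true → walkEnd (embIter (n + 1) (iterBlockOf (n + 1) x)) (pre.map fun l => List.replicate (P.L ^ l.1) (l.2.1.dir, l.2.2)).flatten = embIter l.1 l.2.1.src) ∧
        (l.2.2 = false → walkEnd (embIter (n + 1) (iterBlockOf (n + 1) x)) (pre.map fun l => List.replicate (P.L ^ l.1) (l.2.1.dir, l.2.2)).flatten = embIter l.1 l.2.1.tgt)) ∧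
    (∃ links : List ((m : ℕ) × (PBond P m × Bool)), links.length ≤ P.d * ((P.L - 1) / 2) + 1 ∧
      (∀ l ∈ links, l.1 ≤ k ∧ l.2.1 ∈ bondsOf ((Bj M₁ Z k : DetSet P) l.1)) ∧
      walkEnd (embIter n (iterBlockOf n w)) (links.map fun l => List.replicate (P.L ^ l.1) (l.2.1.dir, l.2.2)).flatten = embIter (n + 1) (iterBlockOf (n + 1) x) ∧
      ∀ (pre post : List ((m : ℕ) × (PBond P m × Bool))) (l : (m : ℕ) × (PBond P m × Bool)), links = pre ++ l :: post →
        (l.2.2 = true → walkEnd (embIter n (iterBlockOf n w)) (pre.map fun l => List.replicate (P.L ^ l.1) (l.2.1.dir, l.2.2)).flatten = embIter l.1 l.2.1.src) ∧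
        (l.2.2 = false → walkEnd (embIter n (iterBlockOf n w)) (pre.map fun l => List.replicate (P.L ^ l.1) (l.2.1.dir, l.2.2)).flatten = embIter l.1 l.2.1.tgt)) := by
  have hn1 : n + 1 ≤ P.m + P.K := hn.trans hk
  set B₀ : Site P (n + 1) := iterBlockOf (n + 1) x with hB₀
  set B₁ : Site P (n + 1) := iterBlockOf (n + 1) w with hB₁
  have hmemw : iterBlockOf n w ∈ (Bj M₁ Z k : DetSet P) n := mem_Bj_pred_of_outside hM2 hdiv hk hn hx hw C hC rfl
  have hmemn : ∀ c : PBond P n, blockOf c.src = B₁ ∧ blockOf c.tgt = B₁ → n ≤ k ∧ c ∈ bondsOf ((Bj M₁ Z k : DetSet P) n) := fun c hc =>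
    ⟨by omega, mem_bondsOf_of_outside hM2 hdiv hk hn hx hw C hC c (Or.inl hc.1)⟩
  have hmemC : n + 1 ≤ k ∧ C ∈ bondsOf ((Bj M₁ Z k : DetSet P) (n + 1)) := by
    refine ⟨hn, ?_⟩
    rcases hC with ⟨h1, -⟩ | ⟨h1, -⟩
    · exact Or.inl (by rw [h1]; exact hx)
    · exact Or.inr (by rw [h1]; exact hx)
  have hblkw : blockOf (iterBlockOf n w) = B₁ := rfl
  have hblke : blockOf (emb B₁) = B₁ := Site.blockOf_emb hn1 B₁
  have hctr : embIter (n + 1) B₁ = embIter n (emb B₁) := rfl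
  -- (b): the coarse link first, then the path inside `B₁` from its centre to `B^n w`
  have mkB : ∀ lC : (m : ℕ) × (PBond P m × Bool), (lC.1 ≤ k ∧ lC.2.1 ∈ bondsOf ((Bj M₁ Z k : DetSet P) lC.1)) →
      ((lC.2.2 = true → embIter (n + 1) B₀ = embIter lC.1 lC.2.1.src) ∧ (lC.2.2 = false → embIter (n + 1) B₀ = embIter lC.1 lC.2.1.tgt)) →
      walkEnd (embIter (n + 1) B₀) ([lC].map fun l => List.replicate (P.L ^ l.1) (l.2.1.dir, l.2.2)).flatten = embIter (n + 1) B₁ →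
      ∃ links : List ((m : ℕ) × (PBond P m × Bool)), links.length ≤ P.d * ((P.L - 1) / 2) + 1 ∧
        (∀ l ∈ links, l.1 ≤ k ∧ l.2.1 ∈ bondsOf ((Bj M₁ Z k : DetSet P) l.1)) ∧
        walkEnd (embIter (n + 1) B₀) (links.map fun l => List.replicate (P.L ^ l.1) (l.2.1.dir, l.2.2)).flatten = embIter n (iterBlockOf n w) ∧
        ∀ (pre post : List ((m : ℕ) × (PBond P m × Bool))) (l : (m : ℕ) × (PBond P m × Bool)), links = pre ++ l :: post →
          (l.2.2 = true → walkEnd (embIter (n + 1) B₀) (pre.map fun l => List.replicate (P.L ^ l.1) (l.2.1.dir, l.2.2)).flatten = embIter l.1 l.2.1.src) ∧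
          (l.2.2 = false → walkEnd (embIter (n + 1) B₀) (pre.map fun l => List.replicate (P.L ^ l.1) (l.2.1.dir, l.2.2)).flatten = embIter l.1 l.2.1.tgt) := by
    intro lC hlCmem hlCst hlCend
    obtain ⟨ch, hlen, hmem, hend, hcons⟩ := exists_blockWalk_centre hn1 (emb B₁) (iterBlockOf n w) B₁ hblke hblkw (Or.inl rfl)
    obtain ⟨hend', hcons'⟩ := chain_of_levelWalk (emb B₁) ch hcons
    rw [hend] at hend'
    refine ⟨[lC] ++ ch.map (fun l => (⟨n, l⟩ : (m : ℕ) × (PBond P m × Bool))), ?_, ?_, ?_, ?_⟩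
    · rw [List.length_append, List.length_singleton, List.length_map]; omega
    · intro l hl
      rcases List.mem_append.mp hl with hl | hl
      · rw [List.mem_singleton.mp hl]; exact hlCmem
      · obtain ⟨l₀, hl₀, rfl⟩ := List.mem_map.mp hl
        exact hmemn l₀.1 (hmem l₀ hl₀)
    · rw [walkEnd_flatten_append, hlCend, hctr]
      exact hend'
    · refine links_append _ _ _ (cons_single lC _ hlCst) fun pre post l h => ?_
      rw [hlCend, hctr]
      exact hcons' pre post l h
  -- (c): the path inside `B₁` from `B^n w` to its centre, then the coarse link
  have mkC : ∀ lC : (m : ℕ) × (PBond P m × Bool), (lC.1 ≤ k ∧ lC.2.1 ∈ bondsOf ((Bj M₁ Z k : DetSet P) lC.1)) →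
      ((lC.2.2 = true → embIter (n + 1) B₁ = embIter lC.1 lC.2.1.src) ∧ (lC.2.2 = false → embIter (n + 1) B₁ = embIter lC.1 lC.2.1.tgt)) →
      walkEnd (embIter (n + 1) B₁) ([lC].map fun l => List.replicate (P.L ^ l.1) (l.2.1.dir, l.2.2)).flatten = embIter (n + 1) B₀ →
      ∃ links : List ((m : ℕ) × (PBond P m × Bool)), links.length ≤ P.d * ((P.L - 1) / 2) + 1 ∧
        (∀ l ∈ links, l.1 ≤ k ∧ l.2.1 ∈ bondsOf ((Bj M₁ Z k : DetSet P) l.1)) ∧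
        walkEnd (embIter n (iterBlockOf n w)) (links.map fun l => List.replicate (P.L ^ l.1) (l.2.1.dir, l.2.2)).flatten = embIter (n + 1) B₀ ∧
        ∀ (pre post : List ((m : ℕ) × (PBond P m × Bool))) (l : (m : ℕ) × (PBond P m × Bool)), links = pre ++ l :: post →
          (l.2.2 = true → walkEnd (embIter n (iterBlockOf n w)) (pre.map fun l => List.replicate (P.L ^ l.1) (l.2.1.dir, l.2.2)).flatten = embIter l.1 l.2.1.src) ∧
          (l.2.2 = false → walkEnd (embIter n (iterBlockOf n w)) (pre.map fun l => List.replicate (P.L ^ l.1) (l.2.1.dir, l.2.2)).flatten = embIter l.1 l.2.1.tgt) := by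
    intro lC hlCmem hlCst hlCend
    obtain ⟨ch, hlen, hmem, hend, hcons⟩ := exists_blockWalk_centre hn1 (iterBlockOf n w) (emb B₁) B₁ hblkw hblke (Or.inr rfl)
    obtain ⟨hend', hcons'⟩ := chain_of_levelWalk (iterBlockOf n w) ch hcons
    rw [hend, ← hctr] at hend'
    refine ⟨ch.map (fun l => (⟨n, l⟩ : (m : ℕ) × (PBond P m × Bool))) ++ [lC], ?_, ?_, ?_, ?_⟩
    · rw [List.length_append, List.length_singleton, List.length_map]; omega
    · intro l hl
      rcases List.mem_append.mp hl with hl | hl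
      · obtain ⟨l₀, hl₀, rfl⟩ := List.mem_map.mp hl
        exact hmemn l₀.1 (hmem l₀ hl₀)
      · rw [List.mem_singleton.mp hl]; exact hlCmem
    · rw [walkEnd_flatten_append, hend']
      exact hlCend
    · refine links_append _ _ _ hcons' fun pre post l h => ?_
      rw [hend']
      exact cons_single lC _ hlCst pre post l h
  refine ⟨hmemw, ?_, ?_⟩
  · rcases hC with ⟨h1, h2⟩ | ⟨h1, h2⟩
    · refine mkB ⟨n + 1, C, true⟩ hmemC ⟨fun _ => by rw [h1], fun h => absurd h (by simp)⟩ ?_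
      rw [walkEnd_single ⟨n + 1, C, true⟩ _ ⟨fun _ => by rw [h1], fun h => absurd h (by simp)⟩]
      simp only [if_true]
      rw [h2]
    · refine mkB ⟨n + 1, C, false⟩ hmemC ⟨fun h => absurd h (by simp), fun _ => by rw [h1]⟩ ?_
      rw [walkEnd_single ⟨n + 1, C, false⟩ _ ⟨fun h => absurd h (by simp), fun _ => by rw [h1]⟩]
      simp only [if_false, Bool.false_eq_true]
      rw [h2]
  · rcases hC with ⟨h1, h2⟩ | ⟨h1, h2⟩
    · refine mkC ⟨n + 1, C, false⟩ hmemC ⟨fun h => absurd h (by simp), fun _ => by rw [h2]⟩ ?_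
      rw [walkEnd_single ⟨n + 1, C, false⟩ _ ⟨fun h => absurd h (by simp), fun _ => by rw [h2]⟩]
      simp only [if_false, Bool.false_eq_true]
      rw [h1]
    · refine mkC ⟨n + 1, C, true⟩ hmemC ⟨fun _ => by rw [h2], fun h => absurd h (by simp)⟩ ?_
      rw [walkEnd_single ⟨n + 1, C, true⟩ _ ⟨fun _ => by rw [h2], fun h => absurd h (by simp)⟩]
      simp only [if_true]
      rw [h1]

/-- ★★ **(v1.1) CHAINS ACROSS `∂Ω_{n+1}`, GRADED**: `exists_chain_across` with the LEVEL GRADE of every link recorded (`≤ n + 1`: the member `(n+1)`-bond and level-`n` members) — for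
dag-n12-w6's LOCATED-GRADING (per-bond transporter budgets `∼ L^{J+1}` at a bond of `Γ`-level `J`, so that the plaquette boxes the Stokes bounds read stay inside the printed collars).
[cite: Balaban1988Convergent, (2.2) p.255, (2.13) pp.256–257; Balaban1985Variational, (16)–(18) p.280; Balaban1985RegularSpaces, (1.7) p.77] -/
theorem exists_chain_across_graded (hM2 : 2 ≤ M₁) (hdiv : side P.L M₁ k ∣ P.sitesPerDir 0) (hk : k ≤ P.m + P.K) {n : ℕ} (hn : n + 1 ≤ k)
    {x w : Site P 0} (hx : iterBlockOf (n + 1) x ∈ (Bj M₁ Z k : DetSet P) (n + 1)) (hw : w ∉ maxDomT M₁ Z (n + 1))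
    (C : PBond P (n + 1)) (hC : (C.src = iterBlockOf (n + 1) x ∧ C.tgt = iterBlockOf (n + 1) w) ∨ (C.tgt = iterBlockOf (n + 1) x ∧ C.src = iterBlockOf (n + 1) w)) :
    iterBlockOf n w ∈ (Bj M₁ Z k : DetSet P) n ∧
    (∃ links : List ((m : ℕ) × (PBond P m × Bool)), links.length ≤ P.d * ((P.L - 1) / 2) + 1 ∧
      (∀ l ∈ links, l.1 ≤ n + 1 ∧ l.1 ≤ k ∧ l.2.1 ∈ bondsOf ((Bj M₁ Z k : DetSet P) l.1)) ∧
      walkEnd (embIter (n + 1) (iterBlockOf (n + 1) x)) (links.map fun l => List.replicate (P.L ^ l.1) (l.2.1.dir, l.2.2)).flatten = embIter n (iterBlockOf n w) ∧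
      ∀ (pre post : List ((m : ℕ) × (PBond P m × Bool))) (l : (m : ℕ) × (PBond P m × Bool)), links = pre ++ l :: post →
        (l.2.2 = true → walkEnd (embIter (n + 1) (iterBlockOf (n + 1) x)) (pre.map fun l => List.replicate (P.L ^ l.1) (l.2.1.dir, l.2.2)).flatten = embIter l.1 l.2.1.src) ∧
        (l.2.2 = false → walkEnd (embIter (n + 1) (iterBlockOf (n + 1) x)) (pre.map fun l => List.replicate (P.L ^ l.1) (l.2.1.dir, l.2.2)).flatten = embIter l.1 l.2.1.tgt)) ∧
    (∃ links : List ((m : ℕ) × (PBond P m × Bool)), links.length ≤ P.d * ((P.L - 1) / 2) + 1 ∧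
      (∀ l ∈ links, l.1 ≤ n + 1 ∧ l.1 ≤ k ∧ l.2.1 ∈ bondsOf ((Bj M₁ Z k : DetSet P) l.1)) ∧
      walkEnd (embIter n (iterBlockOf n w)) (links.map fun l => List.replicate (P.L ^ l.1) (l.2.1.dir, l.2.2)).flatten = embIter (n + 1) (iterBlockOf (n + 1) x) ∧
      ∀ (pre post : List ((m : ℕ) × (PBond P m × Bool))) (l : (m : ℕ) × (PBond P m × Bool)), links = pre ++ l :: post →
        (l.2.2 = true → walkEnd (embIter n (iterBlockOf n w)) (pre.map fun l => List.replicate (P.L ^ l.1) (l.2.1.dir, l.2.2)).flatten = embIter l.1 l.2.1.src) ∧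
        (l.2.2 = false → walkEnd (embIter n (iterBlockOf n w)) (pre.map fun l => List.replicate (P.L ^ l.1) (l.2.1.dir, l.2.2)).flatten = embIter l.1 l.2.1.tgt)) := by
  have hn1 : n + 1 ≤ P.m + P.K := hn.trans hk
  set B₀ : Site P (n + 1) := iterBlockOf (n + 1) x with hB₀
  set B₁ : Site P (n + 1) := iterBlockOf (n + 1) w with hB₁
  have hmemw : iterBlockOf n w ∈ (Bj M₁ Z k : DetSet P) n := mem_Bj_pred_of_outside hM2 hdiv hk hn hx hw C hC rfl
  have hmemn : ∀ c : PBond P n, blockOf c.src = B₁ ∧ blockOf c.tgt = B₁ → n ≤ n + 1 ∧ n ≤ k ∧ c ∈ bondsOf ((Bj M₁ Z k : DetSet P) n) := fun c hc =>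
    ⟨Nat.le_succ n, by omega, mem_bondsOf_of_outside hM2 hdiv hk hn hx hw C hC c (Or.inl hc.1)⟩
  have hmemC : n + 1 ≤ n + 1 ∧ n + 1 ≤ k ∧ C ∈ bondsOf ((Bj M₁ Z k : DetSet P) (n + 1)) := by
    refine ⟨le_rfl, hn, ?_⟩
    rcases hC with ⟨h1, -⟩ | ⟨h1, -⟩
    · exact Or.inl (by rw [h1]; exact hx)
    · exact Or.inr (by rw [h1]; exact hx)
  have hblkw : blockOf (iterBlockOf n w) = B₁ := rfl
  have hblke : blockOf (emb B₁) = B₁ := Site.blockOf_emb hn1 B₁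
  have hctr : embIter (n + 1) B₁ = embIter n (emb B₁) := rfl
  -- (b): the coarse link first, then the path inside `B₁` from its centre to `B^n w`
  have mkB : ∀ lC : (m : ℕ) × (PBond P m × Bool), (lC.1 ≤ n + 1 ∧ lC.1 ≤ k ∧ lC.2.1 ∈ bondsOf ((Bj M₁ Z k : DetSet P) lC.1)) →
      ((lC.2.2 = true → embIter (n + 1) B₀ = embIter lC.1 lC.2.1.src) ∧ (lC.2.2 = false → embIter (n + 1) B₀ = embIter lC.1 lC.2.1.tgt)) →
      walkEnd (embIter (n + 1) B₀) ([lC].map fun l => List.replicate (P.L ^ l.1) (l.2.1.dir, l.2.2)).flatten = embIter (n + 1) B₁ →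
      ∃ links : List ((m : ℕ) × (PBond P m × Bool)), links.length ≤ P.d * ((P.L - 1) / 2) + 1 ∧
        (∀ l ∈ links, l.1 ≤ n + 1 ∧ l.1 ≤ k ∧ l.2.1 ∈ bondsOf ((Bj M₁ Z k : DetSet P) l.1)) ∧
        walkEnd (embIter (n + 1) B₀) (links.map fun l => List.replicate (P.L ^ l.1) (l.2.1.dir, l.2.2)).flatten = embIter n (iterBlockOf n w) ∧
        ∀ (pre post : List ((m : ℕ) × (PBond P m × Bool))) (l : (m : ℕ) × (PBond P m × Bool)), links = pre ++ l :: post →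
          (l.2.2 = true → walkEnd (embIter (n + 1) B₀) (pre.map fun l => List.replicate (P.L ^ l.1) (l.2.1.dir, l.2.2)).flatten = embIter l.1 l.2.1.src) ∧
          (l.2.2 = false → walkEnd (embIter (n + 1) B₀) (pre.map fun l => List.replicate (P.L ^ l.1) (l.2.1.dir, l.2.2)).flatten = embIter l.1 l.2.1.tgt) := by
    intro lC hlCmem hlCst hlCend
    obtain ⟨ch, hlen, hmem, hend, hcons⟩ := exists_blockWalk_centre hn1 (emb B₁) (iterBlockOf n w) B₁ hblke hblkw (Or.inl rfl)
    obtain ⟨hend', hcons'⟩ := chain_of_levelWalk (emb B₁) ch hcons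
    rw [hend] at hend'
    refine ⟨[lC] ++ ch.map (fun l => (⟨n, l⟩ : (m : ℕ) × (PBond P m × Bool))), ?_, ?_, ?_, ?_⟩
    · rw [List.length_append, List.length_singleton, List.length_map]; omega
    · intro l hl
      rcases List.mem_append.mp hl with hl | hl
      · rw [List.mem_singleton.mp hl]; exact hlCmem
      · obtain ⟨l₀, hl₀, rfl⟩ := List.mem_map.mp hl
        exact hmemn l₀.1 (hmem l₀ hl₀)
    · rw [walkEnd_flatten_append, hlCend, hctr]
      exact hend'
    · refine links_append _ _ _ (cons_single lC _ hlCst) fun pre post l h => ?_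
      rw [hlCend, hctr]
      exact hcons' pre post l h
  -- (c): the path inside `B₁` from `B^n w` to its centre, then the coarse link
  have mkC : ∀ lC : (m : ℕ) × (PBond P m × Bool), (lC.1 ≤ n + 1 ∧ lC.1 ≤ k ∧ lC.2.1 ∈ bondsOf ((Bj M₁ Z k : DetSet P) lC.1)) →
      ((lC.2.2 = true → embIter (n + 1) B₁ = embIter lC.1 lC.2.1.src) ∧ (lC.2.2 = false → embIter (n + 1) B₁ = embIter lC.1 lC.2.1.tgt)) →
      walkEnd (embIter (n + 1) B₁) ([lC].map fun l => List.replicate (P.L ^ l.1) (l.2.1.dir, l.2.2)).flatten = embIter (n + 1) B₀ →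
      ∃ links : List ((m : ℕ) × (PBond P m × Bool)), links.length ≤ P.d * ((P.L - 1) / 2) + 1 ∧
        (∀ l ∈ links, l.1 ≤ n + 1 ∧ l.1 ≤ k ∧ l.2.1 ∈ bondsOf ((Bj M₁ Z k : DetSet P) l.1)) ∧
        walkEnd (embIter n (iterBlockOf n w)) (links.map fun l => List.replicate (P.L ^ l.1) (l.2.1.dir, l.2.2)).flatten = embIter (n + 1) B₀ ∧
        ∀ (pre post : List ((m : ℕ) × (PBond P m × Bool))) (l : (m : ℕ) × (PBond P m × Bool)), links = pre ++ l :: post →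
          (l.2.2 = true → walkEnd (embIter n (iterBlockOf n w)) (pre.map fun l => List.replicate (P.L ^ l.1) (l.2.1.dir, l.2.2)).flatten = embIter l.1 l.2.1.src) ∧
          (l.2.2 = false → walkEnd (embIter n (iterBlockOf n w)) (pre.map fun l => List.replicate (P.L ^ l.1) (l.2.1.dir, l.2.2)).flatten = embIter l.1 l.2.1.tgt) := by
    intro lC hlCmem hlCst hlCend
    obtain ⟨ch, hlen, hmem, hend, hcons⟩ := exists_blockWalk_centre hn1 (iterBlockOf n w) (emb B₁) B₁ hblkw hblke (Or.inr rfl)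
    obtain ⟨hend', hcons'⟩ := chain_of_levelWalk (iterBlockOf n w) ch hcons
    rw [hend, ← hctr] at hend'
    refine ⟨ch.map (fun l => (⟨n, l⟩ : (m : ℕ) × (PBond P m × Bool))) ++ [lC], ?_, ?_, ?_, ?_⟩
    · rw [List.length_append, List.length_singleton, List.length_map]; omega
    · intro l hl
      rcases List.mem_append.mp hl with hl | hl
      · obtain ⟨l₀, hl₀, rfl⟩ := List.mem_map.mp hl
        exact hmemn l₀.1 (hmem l₀ hl₀)
      · rw [List.mem_singleton.mp hl]; exact hlCmem
    · rw [walkEnd_flatten_append, hend']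
      exact hlCend
    · refine links_append _ _ _ hcons' fun pre post l h => ?_
      rw [hend']
      exact cons_single lC _ hlCst pre post l h
  refine ⟨hmemw, ?_, ?_⟩
  · rcases hC with ⟨h1, h2⟩ | ⟨h1, h2⟩
    · refine mkB ⟨n + 1, C, true⟩ hmemC ⟨fun _ => by rw [h1], fun h => absurd h (by simp)⟩ ?_
      rw [walkEnd_single ⟨n + 1, C, true⟩ _ ⟨fun _ => by rw [h1], fun h => absurd h (by simp)⟩]
      simp only [if_true]
      rw [h2]
    · refine mkB ⟨n + 1, C, false⟩ hmemC ⟨fun h => absurd h (by simp), fun _ => by rw [h1]⟩ ?_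
      rw [walkEnd_single ⟨n + 1, C, false⟩ _ ⟨fun h => absurd h (by simp), fun _ => by rw [h1]⟩]
      simp only [if_false, Bool.false_eq_true]
      rw [h2]
  · rcases hC with ⟨h1, h2⟩ | ⟨h1, h2⟩
    · refine mkC ⟨n + 1, C, false⟩ hmemC ⟨fun h => absurd h (by simp), fun _ => by rw [h2]⟩ ?_
      rw [walkEnd_single ⟨n + 1, C, false⟩ _ ⟨fun h => absurd h (by simp), fun _ => by rw [h2]⟩]
      simp only [if_false, Bool.false_eq_true]
      rw [h1]
    · refine mkC ⟨n + 1, C, true⟩ hmemC ⟨fun _ => by rw [h2], fun h => absurd h (by simp)⟩ ?_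
      rw [walkEnd_single ⟨n + 1, C, true⟩ _ ⟨fun _ => by rw [h2], fun h => absurd h (by simp)⟩]
      simp only [if_true]
      rw [h1]

end Across

end Summit.QuantumFields.YangMills.BalabanUVNodes.N12BjAcrossChains

end
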